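import Summits.ResolutionOfSingularities.ResolutionOfSingularities.Theorems.FrobeniusLadderFInjectiveMacaulayficationWFixClosedAffineDim2
import Summits.ResolutionOfSingularities.ResolutionOfSingularities.Theorems.FrobeniusLadderFInjectiveMacaulayficationFiniteModificationOfBlowupHolds
import HarnessLib

/-!
# W-LINE RUNG W2 with S-V DISCHARGED — `WFixClosedAffineDim2` modulo Lipman 1978 ONLY (crux `FInjectiveMacaulayfication`
# stmt-ResolutionOfSingularities-15315, chain w45a; res-L1-w45a-plan-1 R13.41 (3) / R13.42; statement res-L1-w45a-strat-1
# `H4LocRepairSig.lean` v1.4 9829be837b63b581 §9′ `stub_rungW2_of_lipman`; prover res-L1-w45a-stub-4)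

[OURS · L1 W4.5a] Support file (`--supports stmt-ResolutionOfSingularities-15315 --as helper`); NOT a statement of any manuscript;
no definitions, no named fact introduced; AI-written (AI review is weaker than expert review). res-L1-w45a-stub-7's
`FiniteModificationOfBlowup.finiteModificationOfBlowupIsBlowup_holds` (S-V1 conductor bound + S-V2 finite-stable blow-up, both
proved) discharges the S-V hypothesis of `WFixClosedAffineDim2.wfixClosedAffineDim2_of_lipman` and of
`RegularBlowupModelDim2.exists_regular_isBlowup_of_lipman`: the W2 rung and the regular blow-up model of affine surfaces now rest
on the named fact `Lipman1978SequenceFinite` (Liu 2002, Thm. 8.3.44) ALONE — strat-1's `stub_rungW2_of_lipman hL` is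
`wfixClosedAffineDim2_of_lipman' hL` by `exact`. [folklore assembly; cite: Liu2002, Thm. 8.3.44 (PDF p. 427)]
-/

-- single-problem summit: the doubled namespace component is forced
set_option linter.dupNamespace false

noncomputable section

open AlgebraicGeometry CategoryTheory Literature.AlgebraicGeometry.Resolution TopologicalSpace

namespace Summit.ResolutionOfSingularities.ResolutionOfSingularities.Theorems.FInjectiveMacaulayfication.WFixClosedAffineDim2

open Summit.ResolutionOfSingularities.ResolutionOfSingularities.Theorems.FInjectiveMacaulayfication

/-- **A regular blow-up model of every affine variety of dimension `≤ 2`, modulo Lipman 1978 only** (S-V discharged by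
`FiniteModificationOfBlowup.finiteModificationOfBlowupIsBlowup_holds`). [cite: Liu2002, Thm. 8.3.44 (PDF p. 427)] -/
theorem exists_regular_isBlowup_of_lipman' (hL : Lipman1978SequenceFinite.{0}) {k : Type} [Field k] (X₁ : Scheme.{0})
    (f₁ : X₁ ⟶ Spec (.of k)) [IsSeparated f₁] [LocallyOfFiniteType f₁] [QuasiCompact f₁] [IsIntegral X₁] [IsAffine X₁]
    (hdim : topologicalKrullDim X₁ ≤ 2) :
    ∃ (Y : Scheme.{0}) (_ : Y ⟶ Spec (.of k)) (π : Y ⟶ X₁) (J : X₁.IdealSheafData),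
      J ≠ ⊥ ∧ IsBlowup π J ∧ Scheme.IsRegular Y :=
  RegularBlowupModelDim2.exists_regular_isBlowup_of_lipman hL FiniteModificationOfBlowup.finiteModificationOfBlowupIsBlowup_holds
    X₁ f₁ hdim

/-- **W2 modulo Lipman 1978 ONLY** — strat-1's `WFixClosedAffineDim2` (v1.4, binders expanded) from the named fact
`Lipman1978SequenceFinite`; `stub_rungW2_of_lipman hL := wfixClosedAffineDim2_of_lipman' hL`. [cite: Liu2002, Thm. 8.3.44 (PDF p. 427)] -/
theorem wfixClosedAffineDim2_of_lipman' (hL : Lipman1978SequenceFinite.{0}) :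
    ∀ (p : ℕ), p.Prime → ∀ (k : Type) [Field k] [CharP k p] (X₁ : Scheme.{0}) (f₁ : X₁ ⟶ Spec (.of k)),
    IsSeparated f₁ → LocallyOfFiniteType f₁ → QuasiCompact f₁ → IsIntegral X₁ → topologicalKrullDim X₁ ≤ 2 → IsAffine X₁ →
    (∀ x : X₁, ∀ d : ℕ, ringKrullDim (X₁.presheaf.stalk x) = d → ∀ s : Fin d → X₁.presheaf.stalk x,
      (Ideal.span (Set.range s)).radical.IsMaximal → RingTheory.Sequence.IsWeaklyRegular (X₁.presheaf.stalk x) (List.ofFn s)) →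
    Set.Finite {x : X₁ | ¬ ∀ d : ℕ, ringKrullDim (X₁.presheaf.stalk x) = d → ∀ s : Fin d → X₁.presheaf.stalk x,
      (Ideal.span (Set.range s)).radical.IsMaximal →
        ∀ y : X₁.presheaf.stalk x, (∃ e : ℕ, y ^ p ^ e ∈ Ideal.span ((fun z : X₁.presheaf.stalk x => z ^ p ^ e) ''
          (Ideal.span (Set.range s) : Set (X₁.presheaf.stalk x)))) → y ∈ Ideal.span (Set.range s)} →
    ∀ b : X₁, IsClosed ({b} : Set X₁) →
      ¬ (∀ d : ℕ, ringKrullDim (X₁.presheaf.stalk b) = d → ∀ s : Fin d → X₁.presheaf.stalk b,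
        (Ideal.span (Set.range s)).radical.IsMaximal →
          ∀ y : X₁.presheaf.stalk b, (∃ e : ℕ, y ^ p ^ e ∈ Ideal.span ((fun z : X₁.presheaf.stalk b => z ^ p ^ e) ''
            (Ideal.span (Set.range s) : Set (X₁.presheaf.stalk b)))) → y ∈ Ideal.span (Set.range s)) →
      ¬ IsIntegrallyClosed (X₁.presheaf.stalk b) →
      ∃ J : X₁.IdealSheafData, J ≠ ⊥ ∧ b ∈ (J.support : Set X₁) ∧
        ∀ (X' : Scheme.{0}) (π : X' ⟶ X₁), IsBlowup π J →
          ∀ x' : X', π.base x' ∈ (J.support : Set X₁) →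
            IsDomain (X'.presheaf.stalk x') ∧ ∀ d : ℕ, ringKrullDim (X'.presheaf.stalk x') = d →
              ∀ s : Fin d → X'.presheaf.stalk x', (Ideal.span (Set.range s)).radical.IsMaximal →
                RingTheory.Sequence.IsWeaklyRegular (X'.presheaf.stalk x') (List.ofFn s) ∧
                ∀ y : X'.presheaf.stalk x', (∃ e : ℕ, y ^ p ^ e ∈ Ideal.span
                  ((fun z : X'.presheaf.stalk x' => z ^ p ^ e) '' (Ideal.span (Set.range s) : Set (X'.presheaf.stalk x')))) →
                  y ∈ Ideal.span (Set.range s) :=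
  wfixClosedAffineDim2_of_lipman hL FiniteModificationOfBlowup.finiteModificationOfBlowupIsBlowup_holds

end Summit.ResolutionOfSingularities.ResolutionOfSingularities.Theorems.FInjectiveMacaulayfication.WFixClosedAffineDim2

end
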